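import Literature.NumberTheory.GaloisRepresentations.DiscreteModuleInverseLimitH2
import HarnessLib

/-!
# Continuous cohomology of an inverse limit of discrete modules, III: `H¹_cont(G, lim M_n) ≅ lim H¹(G, M_n)`

Neukirch–Schmidt–Wingberg, *Cohomology of Number Fields* (2nd ed. 2008), II §7 Thm. (2.7.5) and its
corollary (Tate 1976 §2; finite-group analogue: Harari (2017) Prop. 1.31 p. 44, held
`book:harari2017-galois-cohomology-class-field-theory` p0044), in degree `1`, for the inverse systems
`S : DiscreteInvSystem G M` of `DiscreteModuleInverseLimit.lean` (and the `lim_n H^q` bookkeeping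
`S.cohomologyLimit` of `DiscreteModuleInverseLimitH2.lean`):

* `S.exists_oneCocycle_proj_eq` — SURJECTIVITY of `H¹_cont(G, lim_n M_n) → lim_n H¹(G, M_n)` when the
  transition maps are surjective and the index set has a cofinal chain (exact lifting of continuous
  crossed homomorphisms along the chain: subtract the principal crossed homomorphism of a lift of the
  bounding element);
* `S.oneCocycleClass_eq_zero_of_proj` — INJECTIVITY when the modules `M_n` are finite: the solutions
  `v ∈ M_n` of `f_n = ∂v` form finite non-empty sets, so König's lemma (Mathlib's
  `nonempty_sections_of_finite_inverse_system`) gives a compatible family, i.e. an element of the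
  limit bounding `f` (Mittag-Leffler for `H⁰`);
* `S.continuousCohomologyOneLimitEquiv : H¹_cont(G, lim_n M_n) ≃+ lim_n H¹(G, M_n)` with coordinates
  `H¹(proj_n)`;
* the principal crossed homomorphisms `principalCocycle ρ v` of a jointly continuous representation and
  `finite_contOneCocycles` (`Z¹(Γ, M)` is finite when `M` and `H¹(Γ, M)` are).

Definitions with bodies and theorems; no named fact, no `sorry`.  Cell abc-iut, layer L4 (consumer:
[AbsTopIII] Cor. 1.10 (i)(b) `H¹(G_k, μ_Ẑ(G_k)) ≅ G_k^ab`), but free of any number theory.  VERSION OF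
RECORD for ℕ-TOWERS: the degree-`2` comparison for `ℕ`-indexed towers of discrete `TopRep`s
(`DiscreteTowerPresentation`, `toLimitClasses_surjective`, `limitClassesEquiv`) is abc-iut-L4-t17's
`ContinuousCohomologyTowerLimit.lean` / `ContinuousCohomologyTowerLimitInjective.lean` (landed first);
the `DiscreteInvSystem` files (`DiscreteModuleInverseLimit*.lean`) are the variant over an arbitrary index
relation with a cofinal chain (e.g. `ℕ≥1` under divisibility), with no declaration name in common.
-/

noncomputable section

open CategoryTheory Function

universe v

namespace Literature.NumberTheory.GaloisRepresentations

open _root_.TopRep _root_.ContRepresentation _root_.ContinuousCohomology Opposite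

/-! ### Principal crossed homomorphisms and finiteness of `Z¹` -/

section Principal

variable {Γ : Type v} [Group Γ] [TopologicalSpace Γ] [IsTopologicalGroup Γ]
variable {M : Type v} [AddCommGroup M] [TopologicalSpace M] [DiscreteTopology M]
variable (ρ : ContinuousRep Γ ℤ M)

/-- The **principal crossed homomorphism** `g ↦ g v - v` of a jointly continuous representation, as
a continuous `1`-cocycle. [cite: SerreGaloisCohomology1997, I §5.1] -/
def principalCocycle (v : M) : contOneCocycles ρ.toTopRep :=
  ⟨⟨fun g => ρ g v - v, (ρ.continuous_apply_left v).sub continuous_const⟩, fun g h => by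
    change ρ (g * h) v - v = ρ g v - v + ρ g (ρ h v - v)
    rw [_root_.map_mul, Module.End.mul_apply, map_sub]
    abel⟩

omit [IsTopologicalGroup Γ] in
/-- Values of the principal cocycle. [cite: SerreGaloisCohomology1997, I §5.1] -/
@[simp] theorem principalCocycle_apply (v : M) (g : Γ) : (principalCocycle ρ v).1 g = ρ g v - v :=
  rfl

/-- Principal crossed homomorphisms have trivial class. [cite: SerreGaloisCohomology1997, I §5.1] -/
theorem oneCocycleClass_principalCocycle (v : M) : oneCocycleClass _ (principalCocycle ρ v) = 0 :=
  (oneCocycleClass_eq_zero_iff _ _).2 ⟨v, fun _ => rfl⟩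

/-- **`Z¹(Γ, M)` is finite when `M` and `H¹(Γ, M)` are**: every continuous crossed homomorphism is a
chosen representative of its class plus a principal one. [cite: SerreGaloisCohomology1997, I §5.1] -/
theorem finite_contOneCocycles [Finite M] [Finite (continuousCohomology 1 ρ.toTopRep)] :
    Finite (contOneCocycles ρ.toTopRep) := by
  classical
  choose s hs using oneCocycleClass_surjective ρ.toTopRep
  refine Finite.of_surjective
    (fun p : continuousCohomology 1 ρ.toTopRep × M => s p.1 + principalCocycle ρ p.2) fun φ => ?_
  have h0 : oneCocycleClass _ (φ - s (oneCocycleClass _ φ)) = 0 := by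
    rw [oneCocycleClass_sub, hs, sub_self]
  obtain ⟨v, hv⟩ := (oneCocycleClass_eq_zero_iff _ _).1 h0
  refine ⟨(oneCocycleClass _ φ, v), Subtype.ext (ContinuousMap.ext fun g => ?_)⟩
  have hvg := hv g
  change φ.1 g - (s (oneCocycleClass _ φ)).1 g = ρ g v - v at hvg
  change (s (oneCocycleClass _ φ)).1 g + (ρ g v - v) = φ.1 g
  rw [← hvg]
  abel

end Principal

namespace DiscreteInvSystem

variable {G : Type v} [Group G] [TopologicalSpace G] [IsTopologicalGroup G]
  {ι : Type} {M : ι → Type v} [∀ n, AddCommGroup (M n)] [∀ n, TopologicalSpace (M n)]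
  [∀ n, DiscreteTopology (M n)] (S : DiscreteInvSystem G M)

/-! ### Transition maps and projections on continuous crossed homomorphisms -/

/-- `red` on continuous crossed homomorphisms. [cite: NeukirchSchmidtWingberg2008, II §7 Thm 2.7.5] -/
def redCocycle₁ {n m : ι} (h : S.le n m) (f : contOneCocycles (S.ρ m).toTopRep) :
    contOneCocycles (S.ρ n).toTopRep :=
  contOneCocycles.pullback (ContinuousMonoidHom.id G) (resIdHom (S.redHom h)) f

/-- The projection `lim M → M n` on continuous crossed homomorphisms.
[cite: NeukirchSchmidtWingberg2008, II §7 Thm 2.7.5] -/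
def projCocycle₁ (n : ι) (f : contOneCocycles S.limitRep.toTopRep) :
    contOneCocycles (S.ρ n).toTopRep :=
  contOneCocycles.pullback (ContinuousMonoidHom.id G) (resIdHom (S.projHom n)) f

omit [IsTopologicalGroup G] in
/-- `redCocycle₁` on values. [cite: NeukirchSchmidtWingberg2008, II §7 Thm 2.7.5] -/
@[simp] theorem redCocycle₁_apply {n m : ι} (h : S.le n m) (f : contOneCocycles (S.ρ m).toTopRep)
    (g : G) : (S.redCocycle₁ h f).1 g = S.red h (f.1 g) := rfl

omit [IsTopologicalGroup G] in
/-- `projCocycle₁` on values. [cite: NeukirchSchmidtWingberg2008, II §7 Thm 2.7.5] -/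
@[simp] theorem projCocycle₁_apply (n : ι) (f : contOneCocycles S.limitRep.toTopRep) (g : G) :
    (S.projCocycle₁ n f).1 g = (f.1 g : ∀ n, M n) n := rfl

omit [IsTopologicalGroup G] in
/-- Functoriality of `redCocycle₁`: identities. [cite: NeukirchSchmidtWingberg2008, II §7 Thm 2.7.5] -/
theorem redCocycle₁_refl (n : ι) (f : contOneCocycles (S.ρ n).toTopRep) :
    S.redCocycle₁ (S.le_refl n) f = f :=
  Subtype.ext (ContinuousMap.ext fun g => S.red_refl n (f.1 g))

omit [IsTopologicalGroup G] in
/-- Functoriality of `redCocycle₁`: composition. [cite: NeukirchSchmidtWingberg2008, II §7 Thm 2.7.5] -/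
theorem redCocycle₁_trans {a b d : ι} (h₁ : S.le a b) (h₂ : S.le b d)
    (f : contOneCocycles (S.ρ d).toTopRep) :
    S.redCocycle₁ (S.le_trans h₁ h₂) f = S.redCocycle₁ h₁ (S.redCocycle₁ h₂ f) :=
  Subtype.ext (ContinuousMap.ext fun g => S.red_trans h₁ h₂ (f.1 g))

omit [IsTopologicalGroup G] in
/-- Projections of a crossed homomorphism of the limit are compatible.
[cite: NeukirchSchmidtWingberg2008, II §7 Thm 2.7.5] -/
theorem redCocycle₁_projCocycle₁ {n m : ι} (h : S.le n m) (f : contOneCocycles S.limitRep.toTopRep) :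
    S.redCocycle₁ h (S.projCocycle₁ m f) = S.projCocycle₁ n f :=
  Subtype.ext (ContinuousMap.ext fun g => S.red_apply_coe (f.1 g) h)

omit [IsTopologicalGroup G] in
/-- **A compatible family of continuous crossed homomorphisms defines one of the limit.**
[cite: NeukirchSchmidtWingberg2008, II §7 Thm 2.7.5] -/
def limitCocycle₁ (f : ∀ n, contOneCocycles (S.ρ n).toTopRep)
    (hf : ∀ {n m : ι} (h : S.le n m), S.redCocycle₁ h (f m) = f n) :
    contOneCocycles S.limitRep.toTopRep :=
  ⟨⟨fun g => ⟨fun n => (f n).1 g, fun n _ h =>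
      congrArg (fun φ : contOneCocycles (S.ρ n).toTopRep => φ.1 g) (hf h)⟩,
    continuous_induced_rng.2 (continuous_pi fun n => (f n).1.continuous)⟩,
    fun g h => Subtype.ext (funext fun n => (f n).2 g h)⟩

omit [IsTopologicalGroup G] in
/-- The projections of `limitCocycle₁ f` are the `f n`. [cite: NeukirchSchmidtWingberg2008, II §7 Thm 2.7.5] -/
@[simp] theorem projCocycle₁_limitCocycle₁ (f : ∀ n, contOneCocycles (S.ρ n).toTopRep)
    (hf : ∀ {n m : ι} (h : S.le n m), S.redCocycle₁ h (f m) = f n) (n : ι) :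
    S.projCocycle₁ n (S.limitCocycle₁ f hf) = f n :=
  Subtype.ext (ContinuousMap.ext fun _ => rfl)

/-- `H¹(red) [f] = [red f]`. [cite: NeukirchSchmidtWingberg2008, II §7 Thm 2.7.5] -/
theorem cohomologyMap_redHom_oneCocycleClass {n m : ι} (h : S.le n m)
    (f : contOneCocycles (S.ρ m).toTopRep) :
    cohomologyMap (S.redHom h) 1 (oneCocycleClass _ f) = oneCocycleClass _ (S.redCocycle₁ h f) :=
  cohomologyMap_oneCocycleClass _ f

/-- `H¹(proj n) [f] = [proj n f]`. [cite: NeukirchSchmidtWingberg2008, II §7 Thm 2.7.5] -/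
theorem cohomologyMap_projHom_oneCocycleClass (n : ι) (f : contOneCocycles S.limitRep.toTopRep) :
    cohomologyMap (S.projHom n) 1 (oneCocycleClass _ f) = oneCocycleClass _ (S.projCocycle₁ n f) :=
  cohomologyMap_oneCocycleClass _ f

/-! ### Surjectivity -/

/-- **One step of exact lifting** in degree `1`: if `[red g] = [t]` then some `g'` with `[g'] = [g]`
has `red g' = t` on the nose (subtract the principal crossed homomorphism of a lift of `v`, where
`red g - t = ∂v`). [cite: NeukirchSchmidtWingberg2008, II §7 Thm 2.7.5] -/
theorem exists_redCocycle₁_eq {n m : ι} (h : S.le n m) (hs : Surjective (S.red h))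
    (g : contOneCocycles (S.ρ m).toTopRep) (t : contOneCocycles (S.ρ n).toTopRep)
    (hgt : oneCocycleClass _ (S.redCocycle₁ h g) = oneCocycleClass _ t) :
    ∃ g' : contOneCocycles (S.ρ m).toTopRep,
      oneCocycleClass _ g' = oneCocycleClass _ g ∧ S.redCocycle₁ h g' = t := by
  have h0 : oneCocycleClass _ (S.redCocycle₁ h g - t) = 0 := by
    rw [oneCocycleClass_sub, hgt, sub_self]
  obtain ⟨v, hv⟩ := (oneCocycleClass_eq_zero_iff _ _).1 h0
  obtain ⟨v', hv'⟩ := hs v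
  refine ⟨g - principalCocycle (S.ρ m) v', ?_, ?_⟩
  · rw [oneCocycleClass_sub, oneCocycleClass_principalCocycle, sub_zero]
  · refine Subtype.ext (ContinuousMap.ext fun σ => ?_)
    have hvσ : S.red h (g.1 σ) - t.1 σ = S.ρ n σ v - v := hv σ
    change S.red h (g.1 σ - (S.ρ m σ v' - v')) = t.1 σ
    rw [map_sub, map_sub, S.red_smul, hv', ← hvσ]
    abel

/-- **Surjectivity of `H¹_cont(G, lim_n M_n) → lim_n H¹(G, M_n)`** (surjective transitions, a
cofinal chain). [cite: NeukirchSchmidtWingberg2008, II §7 Thm 2.7.5] -/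
theorem exists_oneCocycle_proj_eq (c : S.CofinalChain)
    (hs : ∀ {n m : ι} (h : S.le n m), Surjective (S.red h))
    (x : ∀ n, continuousCohomology 1 (S.ρ n).toTopRep)
    (hx : ∀ {n m : ι} (h : S.le n m), cohomologyMap (S.redHom h) 1 (x m) = x n) :
    ∃ f : contOneCocycles S.limitRep.toTopRep,
      ∀ n, oneCocycleClass _ (S.projCocycle₁ n f) = x n := by
  classical
  choose g hg using fun n => oneCocycleClass_surjective (S.ρ n).toTopRep (x n)
  let T : ℕ → Type v := fun i =>
    {f : contOneCocycles (S.ρ (c.seq i)).toTopRep // oneCocycleClass _ f = x (c.seq i)}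
  have hstep : ∀ (i : ℕ) (t : T i), ∃ t' : T (i + 1), S.redCocycle₁ (c.le_succ i) t'.1 = t.1 := by
    intro i t
    obtain ⟨g', hg'cl, hg'red⟩ := S.exists_redCocycle₁_eq (c.le_succ i) (hs _)
      (g (c.seq (i + 1))) t.1
      (by rw [← S.cohomologyMap_redHom_oneCocycleClass, hg, hx, t.2])
    exact ⟨⟨g', hg'cl.trans (hg _)⟩, hg'red⟩
  choose step hstep using hstep
  let F : ∀ i, T i := fun i => Nat.rec (motive := T) ⟨g (c.seq 0), hg _⟩ (fun i t => step i t) i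
  have hF : ∀ i, S.redCocycle₁ (c.le_succ i) (F (i + 1)).1 = (F i).1 := fun i => hstep i (F i)
  obtain ⟨z, hz, hzF⟩ := S.exists_extend c (β := fun n => contOneCocycles (S.ρ n).toTopRep)
    (fun h f => S.redCocycle₁ h f) (fun n f => S.redCocycle₁_refl n f)
    (fun h₁ h₂ f => S.redCocycle₁_trans h₁ h₂ f) (fun i => (F i).1) hF
  refine ⟨S.limitCocycle₁ z hz, fun n => ?_⟩
  have hzn : S.redCocycle₁ (c.le_idx n) (z (c.seq (c.idx n))) = z n := hz (c.le_idx n)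
  rw [S.projCocycle₁_limitCocycle₁, ← hzn, hzF, ← S.cohomologyMap_redHom_oneCocycleClass,
    (F (c.idx n)).2, hx]

/-! ### Injectivity (finite modules) -/

/-- **Injectivity of `H¹_cont(G, lim_n M_n) → lim_n H¹(G, M_n)` for finite `M_n`**: a continuous
crossed homomorphism of the limit whose projections along a cofinal chain are principal is principal
(König on the finite non-empty sets of bounding elements). [cite: NeukirchSchmidtWingberg2008, II §7 Thm 2.7.5] -/
theorem oneCocycleClass_eq_zero_of_proj (c : S.CofinalChain) (hfin : ∀ n, Finite (M n))
    (f : contOneCocycles S.limitRep.toTopRep)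
    (hf : ∀ i, oneCocycleClass _ (S.projCocycle₁ (c.seq i) f) = 0) :
    oneCocycleClass _ f = 0 := by
  classical
  let Sol : ℕ → Type v := fun i =>
    {v : M (c.seq i) // ∀ g, (S.projCocycle₁ (c.seq i) f).1 g = S.ρ (c.seq i) g v - v}
  have hne : ∀ i, Nonempty (Sol i) := fun i => by
    obtain ⟨v, hv⟩ := (oneCocycleClass_eq_zero_iff _ _).1 (hf i)
    exact ⟨⟨v, hv⟩⟩
  have hfinSol : ∀ i, Finite (Sol i) := fun i => by
    haveI := hfin (c.seq i)
    exact Subtype.finite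
  have hmem : ∀ {i j : ℕ} (hji : j ≤ i) (v : Sol i) (g : G),
      (S.projCocycle₁ (c.seq j) f).1 g =
        S.ρ (c.seq j) g (S.red (c.le_of_le hji) v.1) - S.red (c.le_of_le hji) v.1 := by
    intro i j hji v g
    rw [← S.red_smul, ← map_sub, ← v.2 g]
    exact (S.red_apply_coe (f.1 g) (c.le_of_le hji)).symm
  let F : ℕᵒᵖ ⥤ Type v :=
    { obj := fun i => Sol i.unop
      map := fun {i j} φ => TypeCat.ofHom fun v : Sol i.unop =>
        (⟨S.red (c.le_of_le φ.unop.le) v.1, hmem φ.unop.le v⟩ : Sol j.unop)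
      map_id := fun i => ConcreteCategory.hom_ext _ _ fun v => Subtype.ext (S.red_refl _ _)
      map_comp := fun φ ψ => ConcreteCategory.hom_ext _ _ fun v => Subtype.ext (S.red_trans _ _ _) }
  haveI : ∀ j : ℕᵒᵖ, Finite (F.obj j) := fun j => hfinSol j.unop
  haveI : ∀ j : ℕᵒᵖ, Nonempty (F.obj j) := fun j => hne j.unop
  obtain ⟨u, hu⟩ := nonempty_sections_of_finite_inverse_system F
  let yv : ∀ i, M (c.seq i) := fun i => (u (op i)).1
  have hyv : ∀ i, S.red (c.le_succ i) (yv (i + 1)) = yv i := fun i =>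
    congrArg Subtype.val (hu (CategoryTheory.homOfLE (Nat.le_succ i)).op)
  obtain ⟨V, hV, hVy⟩ := S.exists_extend c (β := fun n => M n) (fun h v => S.red h v)
    (fun n v => S.red_refl n v) (fun h₁ h₂ v => S.red_trans h₁ h₂ v) yv hyv
  refine (oneCocycleClass_eq_zero_iff _ _).2 ⟨⟨V, fun n m h => hV h⟩, fun σ =>
    Subtype.ext (funext fun n => ?_)⟩
  change ((f.1 σ : S.limit) : ∀ n, M n) n = S.ρ n σ (V n) - V n
  have hVn : V n = S.red (c.le_idx n) (yv (c.idx n)) := by rw [← hV (c.le_idx n), hVy]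
  rw [← S.red_apply_coe (f.1 σ) (c.le_idx n), hVn, ← S.red_smul, ← map_sub]
  exact congrArg (S.red (c.le_idx n)) ((u (op (c.idx n))).2 σ)

/-! ### The comparison isomorphism -/

/-- **The comparison map `H¹_cont(G, lim_n M_n) → lim_n H¹(G, M_n)`**, `y ↦ (H¹(proj_n) y)_n`.
[cite: NeukirchSchmidtWingberg2008, II §7 Thm 2.7.5] -/
def toCohomologyLimit₁ : continuousCohomology 1 S.limitRep.toTopRep →+ S.cohomologyLimit 1 where
  toFun y := ⟨fun n => cohomologyMap (S.projHom n) 1 y, fun n m h => by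
    obtain ⟨f, rfl⟩ := oneCocycleClass_surjective _ y
    change cohomologyMap (S.redHom h) 1 (cohomologyMap (S.projHom m) 1 (oneCocycleClass _ f)) =
      cohomologyMap (S.projHom n) 1 (oneCocycleClass _ f)
    rw [cohomologyMap_projHom_oneCocycleClass, cohomologyMap_projHom_oneCocycleClass,
      cohomologyMap_redHom_oneCocycleClass, redCocycle₁_projCocycle₁]⟩
  map_zero' := Subtype.ext (funext fun n => by simp)
  map_add' y y' := Subtype.ext (funext fun n => by simp [map_add])

/-- Coordinates of the comparison map. [cite: NeukirchSchmidtWingberg2008, II §7 Thm 2.7.5] -/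
@[simp] theorem coe_toCohomologyLimit₁_apply (y : continuousCohomology 1 S.limitRep.toTopRep) (n : ι) :
    (S.toCohomologyLimit₁ y : ∀ n, continuousCohomology 1 (S.ρ n).toTopRep) n =
      cohomologyMap (S.projHom n) 1 y := rfl

/-- **Surjectivity** of `H¹_cont(G, lim_n M_n) → lim_n H¹(G, M_n)`.
[cite: NeukirchSchmidtWingberg2008, II §7 Thm 2.7.5] -/
theorem toCohomologyLimit₁_surjective (c : S.CofinalChain)
    (hs : ∀ {n m : ι} (h : S.le n m), Surjective (S.red h)) :
    Surjective S.toCohomologyLimit₁ := by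
  intro x
  obtain ⟨f, hf⟩ := S.exists_oneCocycle_proj_eq c hs x.1 (fun h => x.2 h)
  refine ⟨oneCocycleClass _ f, Subtype.ext (funext fun n => ?_)⟩
  rw [coe_toCohomologyLimit₁_apply, cohomologyMap_projHom_oneCocycleClass, hf]

/-- **Injectivity** of `H¹_cont(G, lim_n M_n) → lim_n H¹(G, M_n)` for finite `M_n`.
[cite: NeukirchSchmidtWingberg2008, II §7 Thm 2.7.5] -/
theorem toCohomologyLimit₁_injective (c : S.CofinalChain) (hfin : ∀ n, Finite (M n)) :
    Injective S.toCohomologyLimit₁ := by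
  refine (injective_iff_map_eq_zero _).2 fun y hy => ?_
  obtain ⟨f, rfl⟩ := oneCocycleClass_surjective _ y
  refine S.oneCocycleClass_eq_zero_of_proj c hfin f fun i => ?_
  have h := congrArg (fun x : S.cohomologyLimit 1 =>
    (x : ∀ n, continuousCohomology 1 (S.ρ n).toTopRep) (c.seq i)) hy
  simpa [cohomologyMap_projHom_oneCocycleClass] using h

/-- **`H¹_cont(G, lim_n M_n) ≃ lim_n H¹(G, M_n)`** (NSW Thm. 2.7.5 in degree `1`): for an inverse system of
FINITE discrete `G`-modules with surjective transition maps over an index set with a cofinal chain, the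
comparison map is an isomorphism of abelian groups. [cite: NeukirchSchmidtWingberg2008, II §7 Thm 2.7.5] -/
def continuousCohomologyOneLimitEquiv (c : S.CofinalChain)
    (hs : ∀ {n m : ι} (h : S.le n m), Surjective (S.red h)) (hfin : ∀ n, Finite (M n)) :
    continuousCohomology 1 S.limitRep.toTopRep ≃+ S.cohomologyLimit 1 :=
  AddEquiv.ofBijective S.toCohomologyLimit₁
    ⟨S.toCohomologyLimit₁_injective c hfin, S.toCohomologyLimit₁_surjective c hs⟩

/-- Coordinates of the comparison isomorphism. [cite: NeukirchSchmidtWingberg2008, II §7 Thm 2.7.5] -/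
@[simp] theorem coe_continuousCohomologyOneLimitEquiv_apply (c : S.CofinalChain)
    (hs : ∀ {n m : ι} (h : S.le n m), Surjective (S.red h)) (hfin : ∀ n, Finite (M n))
    (y : continuousCohomology 1 S.limitRep.toTopRep) (n : ι) :
    (S.continuousCohomologyOneLimitEquiv c hs hfin y : ∀ n, continuousCohomology 1 (S.ρ n).toTopRep) n
      = cohomologyMap (S.projHom n) 1 y := rfl

end DiscreteInvSystem

end Literature.NumberTheory.GaloisRepresentations
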